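import Mathlib
import HarnessLib

/-!
# Class sums of the 2-adic lift of a balanced chirp

Stub E1 of the cycle-6 ("bottom-end chirps") section of line Sketch/LAR of crux
`Summit.QuantumAdvantage.QuantumAdvantage.Theses.MobiusLadder.DigitPolyUniformity`
(stmt-QuantumAdvantage-1392).

Setting. `φ : ℕ → ℝ` has period `2^k` and sums to zero over every class
`{u < 2^k : u ≡ w (mod 2^j)}` with `w` odd and `1 ≤ j ≤ C' + 1`. A function `f : ℕ → ℝ` is a *lift* of `φ`
to depth `V` if `f r = 1` whenever `2^V ∣ r` and `f (2^v r') = (-1)^v φ r'` for `v < V` and odd `r'`.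

Result (`stub_lift_classSum`). If `C' < k` and `C' ≤ V`, then on the period `[0, 2^(V+k))` the lift sums to
`2^k` over the class `r ≡ 0 (mod 2^C')` (the `2^k` multiples of `2^V` contribute `1` each, everything else
cancels) and to `0` over every other class modulo `2^C'` (`classSum_eq`); consequently
`Σ_{r₀ < 2^C'} |Σ_{r < 2^(V+k), r ≡ r₀ (2^C')} f r| ≤ 2^k`.

Proof. Two inductions, each peeling off the lowest binary digit with the even/odd splitting
`Σ_{x < 2n} F x = Σ_{s < n} F (2s) + Σ_{s < n} F (2s+1)` (`sum_range_two_mul`):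
* `sum_lift_eq` (the full sum, induction on `V`): the even half of `[0, 2^(V+1+k))` is the full sum of the
  lift `s ↦ f (2s)` of `-φ` to depth `V`; the odd half is `Σ φ` over the odd numbers below `2^(V+1+k)`, which
  is `2^(V+1)` copies of `Σ_{u < 2^k odd} φ u = 0` by periodicity (`sum_filter_mul_eq`).
* `classSum_eq` (induction on `C'`): an odd class modulo `2^(C'+1)` consists of odd numbers, on which
  `f = φ`, and its sum is `2^V` copies of a balanced class sum of `φ`; an even class `r₀ = 2 r₁` is the even
  half, i.e. the class of `r₁` modulo `2^C'` for the lift `s ↦ f (2s)` of `-φ` to depth `V - 1`.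

The hypothesis `C' < k` (rather than `C' ≤ k`) is needed: for `k = 0`, `V = 1`, `C' = 0`, `φ = f = 1` all
hypotheses hold and the class sum is `2 > 2^0`.
-/

noncomputable section

namespace Summit.QuantumAdvantage.DigitPolyUniformity.SketchLAR.Chirp

open Finset

namespace LiftClassSum

/-- Even/odd splitting of a sum over `[0, 2n)`:
`Σ_{x < 2n} F x = Σ_{s < n} F (2s) + Σ_{s < n} F (2s + 1)`. [folklore] -/
theorem sum_range_two_mul (F : ℕ → ℝ) (n : ℕ) :
    ∑ x ∈ range (2 * n), F x = ∑ s ∈ range n, F (2 * s) + ∑ s ∈ range n, F (2 * s + 1) := by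
  induction n with
  | zero => simp
  | succ n ih =>
    rw [show 2 * (n + 1) = 2 * n + 1 + 1 by ring, sum_range_succ, sum_range_succ, ih,
      sum_range_succ, sum_range_succ]
    ring

/-- Periodicity: if `φ` has period `2^k` and `j ≤ k`, the sum of `φ` over the class
`{u < n·2^k : u % 2^j = c}` is `n` times its sum over `{u < 2^k : u % 2^j = c}`. [folklore] -/
theorem sum_filter_mul_eq (k j c : ℕ) (hj : j ≤ k) (φ : ℕ → ℝ)
    (hφper : ∀ u, φ (u % 2 ^ k) = φ u) (n : ℕ) :
    ∑ u ∈ (range (n * 2 ^ k)).filter (fun u => u % 2 ^ j = c), φ u =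
      n * ∑ u ∈ (range (2 ^ k)).filter (fun u => u % 2 ^ j = c), φ u := by
  induction n with
  | zero => simp
  | succ n ih =>
    simp only [Finset.sum_filter] at ih ⊢
    rw [add_one_mul, Finset.sum_range_add, ih]
    have hshift : ∀ x, (if (n * 2 ^ k + x) % 2 ^ j = c then φ (n * 2 ^ k + x) else 0) =
        (if x % 2 ^ j = c then φ x else 0) := by
      intro x
      obtain ⟨t, ht⟩ : 2 ^ j ∣ 2 ^ k := pow_dvd_pow 2 hj
      have h1 : (n * 2 ^ k + x) % 2 ^ j = x % 2 ^ j := by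
        rw [ht, show n * (2 ^ j * t) + x = x + 2 ^ j * (n * t) by ring,
          Nat.add_mul_mod_self_left]
      have h2 : φ (n * 2 ^ k + x) = φ x := by
        rw [← hφper (n * 2 ^ k + x), show n * 2 ^ k + x = x + 2 ^ k * n by ring,
          Nat.add_mul_mod_self_left, hφper]
      rw [h1, h2]
    rw [Finset.sum_congr rfl fun x _ => hshift x]
    push_cast
    ring

/-- The full sum of a lift: if `φ` has period `2^k` (`1 ≤ k`) and `Σ_{u < 2^k odd} φ u = 0`, and
`f = 1` on the multiples of `2^V`, `f (2^v r') = (-1)^v φ r'` for `v < V`, `r'` odd, then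
`Σ_{r < 2^(V+k)} f r = 2^k`. Induction on `V` (even/odd splitting). [folklore] -/
theorem sum_lift_eq (k : ℕ) (hk : 1 ≤ k) :
    ∀ (V : ℕ) (φ : ℕ → ℝ), (∀ u, φ (u % 2 ^ k) = φ u) →
      ∑ u ∈ (range (2 ^ k)).filter (fun u => u % 2 ^ 1 = 1), φ u = 0 →
      ∀ f : ℕ → ℝ, (∀ r, 2 ^ V ∣ r → f r = 1) →
      (∀ v r', v < V → Odd r' → f (2 ^ v * r') = (-1) ^ v * φ r') →
      ∑ r ∈ range (2 ^ (V + k)), f r = 2 ^ k := by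
  intro V
  induction V with
  | zero =>
    intro φ _ _ f hf0 _
    rw [zero_add, Finset.sum_eq_card_nsmul fun r _ => hf0 r (by simp)]
    simp
  | succ V ih =>
    intro φ hφper hφodd f hf0 hfv
    have h2 : 2 ^ (V + 1 + k) = 2 * 2 ^ (V + k) := by ring
    rw [h2, sum_range_two_mul]
    -- the even half: the lift `s ↦ f (2 s)` of `-φ` to depth `V`
    have heven : ∑ s ∈ range (2 ^ (V + k)), f (2 * s) = 2 ^ k := by
      refine ih (fun u => -φ u) (fun u => ?_) ?_ (fun s => f (2 * s)) (fun r hr => ?_)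
        (fun v r' hv hr' => ?_)
      · show -φ (u % 2 ^ k) = -φ u
        rw [hφper]
      · show ∑ u ∈ (range (2 ^ k)).filter (fun u => u % 2 ^ 1 = 1), -φ u = 0
        rw [Finset.sum_neg_distrib, hφodd, neg_zero]
      · exact hf0 (2 * r) (by rw [pow_succ']; exact mul_dvd_mul_left 2 hr)
      · show f (2 * (2 ^ v * r')) = (-1) ^ v * -φ r'
        have := hfv (v + 1) r' (by omega) hr'
        rw [pow_succ', mul_assoc] at this
        rw [this, pow_succ]
        ring
    -- the odd half: `f = φ` on odd numbers, and `φ` is balanced on the odd numbers of each period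
    have hodd : ∑ s ∈ range (2 ^ (V + k)), f (2 * s + 1) = 0 := by
      have h1 : ∀ s, f (2 * s + 1) = φ (2 * s + 1) := fun s => by
        simpa using hfv 0 (2 * s + 1) (by omega) ⟨s, rfl⟩
      simp_rw [h1]
      have h3 := sum_filter_mul_eq k 1 1 hk φ hφper (2 ^ (V + 1))
      rw [hφodd, mul_zero, ← pow_add, h2, Finset.sum_filter, sum_range_two_mul] at h3
      have h4 : ∀ s, (if (2 * s) % 2 ^ 1 = 1 then φ (2 * s) else 0) = 0 := fun s => by
        rw [if_neg]
        rw [pow_one, Nat.even_iff.1 (even_two_mul s)]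
        exact Nat.zero_ne_one
      have h5 : ∀ s, (if (2 * s + 1) % 2 ^ 1 = 1 then φ (2 * s + 1) else 0) = φ (2 * s + 1) :=
        fun s => by rw [if_pos]; rw [pow_one]; exact Nat.odd_iff.1 ⟨s, rfl⟩
      simp_rw [h4, h5] at h3
      simpa using h3
    rw [heven, hodd, add_zero]

/-- The class sums of a lift, exactly: under the hypotheses of `stub_lift_classSum` (with `1 ≤ k`,
`C' ≤ k`, `C' ≤ V`), for `r₀ < 2^C'` the sum of `f` over `{r < 2^(V+k) : r % 2^C' = r₀}` is `2^k` if
`r₀ = 0` and `0` otherwise. Induction on `C'` (even/odd splitting; the base case is `sum_lift_eq`).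
[folklore] -/
theorem classSum_eq (k : ℕ) (hk : 1 ≤ k) :
    ∀ (C' V : ℕ), C' ≤ k → C' ≤ V → ∀ φ : ℕ → ℝ, (∀ u, φ (u % 2 ^ k) = φ u) →
      (∀ j, 1 ≤ j → j ≤ C' + 1 → ∀ w, Odd w →
        ∑ u ∈ (range (2 ^ k)).filter (fun u => u % 2 ^ j = w % 2 ^ j), φ u = 0) →
      ∀ f : ℕ → ℝ, (∀ r, 2 ^ V ∣ r → f r = 1) →
      (∀ v r', v < V → Odd r' → f (2 ^ v * r') = (-1) ^ v * φ r') →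
      ∀ r₀, r₀ < 2 ^ C' →
      ∑ r ∈ (range (2 ^ (V + k))).filter (fun r => r % 2 ^ C' = r₀), f r =
        if r₀ = 0 then 2 ^ k else 0 := by
  intro C'
  induction C' with
  | zero =>
    intro V _ _ φ hφper hbal f hf0 hfv r₀ hr₀
    rw [pow_zero, Nat.lt_one_iff] at hr₀
    subst hr₀
    rw [if_pos rfl]
    have hall : (range (2 ^ (V + k))).filter (fun r => r % 2 ^ 0 = 0) = range (2 ^ (V + k)) :=
      Finset.filter_true_of_mem fun r _ => by rw [pow_zero, Nat.mod_one]
    rw [hall]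
    refine sum_lift_eq k hk V φ hφper ?_ f hf0 hfv
    have := hbal 1 le_rfl (by omega) 1 odd_one
    rwa [show (1 : ℕ) % 2 ^ 1 = 1 by norm_num] at this
  | succ C' ih =>
    intro V hCk hCV φ hφper hbal f hf0 hfv r₀ hr₀
    rcases Nat.even_or_odd r₀ with ⟨r₁, hr₁⟩ | hodd
    · -- even class `r₀ = 2 r₁`: the even half is the class of `r₁` modulo `2^C'` for `s ↦ f (2 s)`
      obtain ⟨V', rfl⟩ : ∃ V', V = V' + 1 := ⟨V - 1, by omega⟩
      have h2 : 2 ^ (V' + 1 + k) = 2 * 2 ^ (V' + k) := by ring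
      rw [Finset.sum_filter, h2, sum_range_two_mul]
      have hodd0 : ∀ s, ¬ ((2 * s + 1) % 2 ^ (C' + 1) = r₀) := by
        intro s h
        have h' : (2 * s + 1) % 2 ^ (C' + 1) % 2 = r₀ % 2 := by rw [h]
        rw [Nat.mod_mod_of_dvd _ (dvd_pow_self 2 (Nat.succ_ne_zero C')), hr₁] at h'
        omega
      have heven : ∀ s, ((2 * s) % 2 ^ (C' + 1) = r₀ ↔ s % 2 ^ C' = r₁) := by
        intro s
        rw [pow_succ', Nat.mul_mod_mul_left, hr₁]
        omega
      have hsum_odd : ∑ s ∈ range (2 ^ (V' + k)),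
          (if (2 * s + 1) % 2 ^ (C' + 1) = r₀ then f (2 * s + 1) else 0) = 0 :=
        Finset.sum_eq_zero fun s _ => if_neg (hodd0 s)
      have hsum_even : ∑ s ∈ range (2 ^ (V' + k)),
          (if (2 * s) % 2 ^ (C' + 1) = r₀ then f (2 * s) else 0) =
          ∑ s ∈ (range (2 ^ (V' + k))).filter (fun s => s % 2 ^ C' = r₁), f (2 * s) := by
        rw [Finset.sum_filter]
        exact Finset.sum_congr rfl fun s _ => if_congr (heven s) rfl rfl
      rw [hsum_odd, add_zero, hsum_even]
      have key : ∑ s ∈ (range (2 ^ (V' + k))).filter (fun s => s % 2 ^ C' = r₁), f (2 * s) =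
          if r₁ = 0 then 2 ^ k else 0 := by
        refine ih V' (by omega) (by omega) (fun u => -φ u) (fun u => ?_) (fun j hj1 hj2 w hw => ?_)
          (fun s => f (2 * s)) (fun r hr => ?_) (fun v r' hv hr' => ?_) r₁ ?_
        · show -φ (u % 2 ^ k) = -φ u
          rw [hφper]
        · show ∑ u ∈ (range (2 ^ k)).filter (fun u => u % 2 ^ j = w % 2 ^ j), -φ u = 0
          rw [Finset.sum_neg_distrib, hbal j hj1 (by omega) w hw, neg_zero]
        · exact hf0 (2 * r) (by rw [pow_succ']; exact mul_dvd_mul_left 2 hr)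
        · show f (2 * (2 ^ v * r')) = (-1) ^ v * -φ r'
          have := hfv (v + 1) r' (by omega) hr'
          rw [pow_succ', mul_assoc] at this
          rw [this, pow_succ]
          ring
        · have := pow_succ' 2 C'
          omega
      rw [key]
      by_cases h : r₁ = 0
      · rw [if_pos h, if_pos (by omega)]
      · rw [if_neg h, if_neg (by omega)]
    · -- odd class: it consists of odd numbers, on which `f = φ`
      have hV : 0 < V := by omega
      have hf_odd : ∀ r ∈ (range (2 ^ (V + k))).filter (fun r => r % 2 ^ (C' + 1) = r₀),
          f r = φ r := by
        intro r hr
        have hr2 := (Finset.mem_filter.1 hr).2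
        have hr_odd : Odd r := by
          have h' : r % 2 ^ (C' + 1) % 2 = r₀ % 2 := by rw [hr2]
          rw [Nat.mod_mod_of_dvd _ (dvd_pow_self 2 (Nat.succ_ne_zero C'))] at h'
          rw [Nat.odd_iff, h', ← Nat.odd_iff]
          exact hodd
        simpa using hfv 0 r hV hr_odd
      rw [Finset.sum_congr rfl hf_odd]
      have hmul := sum_filter_mul_eq k (C' + 1) r₀ hCk φ hφper (2 ^ V)
      rw [← pow_add] at hmul
      have hb := hbal (C' + 1) (by omega) (by omega) r₀ hodd
      rw [Nat.mod_eq_of_lt hr₀] at hb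
      rw [hmul, hb, mul_zero, if_neg]
      obtain ⟨m, hm⟩ := hodd
      omega

end LiftClassSum

/-- **Stub E1 (class sums of the lift).** If `φ` (period `2^k`) sums to zero on every odd class modulo
`2^j`, `1 ≤ j ≤ C' + 1`, and `C' < k`, `C' ≤ V`, then the lift `f` (`f = 1` on the multiples of `2^V`,
`f (2^v r') = (-1)^v φ r'` for `v < V`, `r'` odd) sums to `0` on every class `r ≡ r₀ (mod 2^C')` of
`[0, 2^(V+k))` with `r₀ ≠ 0`, and to `2^k` on the class of `0`; in particular
`Σ_{r₀ < 2^C'} |Σ_{r ≡ r₀} f r| ≤ 2^k`. (For `k = 0 < V` the bound fails, whence `C' < k`.) [folklore] -/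
theorem stub_lift_classSum (k V C' : ℕ) (hC'k : C' < k) (hC'V : C' ≤ V) (φ : ℕ → ℝ)
    (hφper : ∀ u, φ (u % 2 ^ k) = φ u)
    (hbal : ∀ j, 1 ≤ j → j ≤ C' + 1 → ∀ w, Odd w →
      ∑ u ∈ (range (2 ^ k)).filter (fun u => u % 2 ^ j = w % 2 ^ j), φ u = 0)
    (f : ℕ → ℝ) (hf0 : ∀ r, 2 ^ V ∣ r → f r = 1)
    (hfv : ∀ v r', v < V → Odd r' → f (2 ^ v * r') = (-1) ^ v * φ r') :
    ∑ r₀ ∈ range (2 ^ C'), |∑ r ∈ (range (2 ^ (V + k))).filter (fun r => r % 2 ^ C' = r₀), f r| ≤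
      2 ^ k := by
  have h := LiftClassSum.classSum_eq k (by omega) C' V hC'k.le hC'V φ hφper hbal f hf0 hfv
  have h2 : ∀ r₀ ∈ range (2 ^ C'),
      |∑ r ∈ (range (2 ^ (V + k))).filter (fun r => r % 2 ^ C' = r₀), f r| =
        if r₀ = 0 then (2 : ℝ) ^ k else 0 := by
    intro r₀ hr₀
    rw [h r₀ (Finset.mem_range.1 hr₀)]
    split_ifs
    · exact abs_of_nonneg (by positivity)
    · exact abs_zero
  rw [Finset.sum_congr rfl h2, Finset.sum_ite_eq', if_pos (Finset.mem_range.2 (Nat.two_pow_pos C'))]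

end Summit.QuantumAdvantage.DigitPolyUniformity.SketchLAR.Chirp
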